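import Summits.QuantumFields.YangMills.Theorems.FemtoTransferGapRungW1upLink
import Literature.MathematicalPhysics.QuantumFieldTheory.SU2OneLinkMoments
import HarnessLib

/-!
# Sharp one-link moments in the W1-up chain's currency: `12/(4B+3) ≤ linkM2 B / linkC B ≤ 3/B`, `|linkM2/linkC − 3/B| ≤ 9/(4B²)`, `E_B‖W−1‖⁴ ≤ 15/B²`
# (support module for the registered stubs `stub_absLowerAL1` (kinetic term) and `stub_absUpperInnerAL1` / `stub_absUpperValleyMag` (IMS error constants) of crux
# `OneSiteLevels`, route `LuscherReduction`, item stmt-QuantumFields-20007; cell `ym-beyond`, seat lit g7)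

The chain (`FemtoTransferGapRungW1upLink`) has `linkC B = ∫ e^{B Re tr W} dW`, `linkM2 B = ∫ ‖W − 1‖_F² e^{B Re tr W} dW` and the Laplace bound
`linkM2_le : linkM2 B ≤ (cM2/B) · linkC B` with `cM2 = (8/3)·5¹⁶`.  The Literature module `SU2OneLinkMoments` (exact integration-by-parts identities for the
class-angle law) gives the SHARP version asked for by card `Lines-energy-lower-abs-v2.md` §2 («`oneLink_frobSq_moment_sharp`»); this file merely unfolds the
chain's definitions:

* `linkM2_le_three_div` — `linkM2 B ≤ (3/B) · linkC B` (`B > 0`): `cM2` may be replaced by `3` in `defectRow_le_of_pos` and every IMS error constant;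
* `mul_linkC_le_linkM2` — `12 · linkC B ≤ (4B+3) · linkM2 B` (`B ≥ 0`);
* `linkM2_div_linkC_mem_Icc` — `linkM2 B / linkC B ∈ [12/(4B+3), 3/B]`; `abs_linkM2_div_linkC_sub_le` — **`|linkM2 B / linkC B − 3/B| ≤ 9/(4B²)`** (`B > 0`);
* `linkM4_le` / `linkM4_div_linkC_le` — the fourth Hilbert–Schmidt moment `∫ ‖W − 1‖_F⁴ e^{B Re tr W} dW ≤ (15/B²) · linkC B`;
* `linkM4_eq` — exactly `B · ∫ ‖W − 1‖_F⁴ e^{B Re tr W} = 2(4B+3) · linkM2 B − 24 · linkC B`.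

## WHAT THIS IS NOT
NOT the crux, NOT THE CLAY GAP.  Sorry-free; no new definition, no named fact.
-/

set_option autoImplicit false

noncomputable section

open MeasureTheory Filter Topology Real
open Literature.MathematicalPhysics.QuantumFieldTheory
open Literature.MathematicalPhysics.QuantumLattice
open Literature.MathematicalPhysics.QuantumFieldTheory.SU2OneLink

namespace Summit.QuantumFields.YangMills.Theorems.FemtoTransferGap

/-- **`linkM2 B ≤ (3/B) · linkC B`** for `B > 0` — the sharp form of the chain's `linkM2_le` (constant `3` in place of `cM2 = (8/3)5¹⁶`).
[cite: MontvayMunster1994, §3.2.3 (3.96)-(3.97) p.121] -/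
theorem linkM2_le_three_div {B : ℝ} (hB : 0 < B) : linkM2 B ≤ 3 / B * linkC B := by
  unfold linkM2 linkC linkW
  exact integral_frobNorm_sub_one_sq_mul_exp_le hB

/-- **`12 · linkC B ≤ (4B+3) · linkM2 B`** for `B ≥ 0` (the matching lower bound, `E_B‖W−1‖_F² ≥ 12/(4B+3)`). [cite: DLMF, 10.29.1] -/
theorem mul_linkC_le_linkM2 {B : ℝ} (hB : 0 ≤ B) : 12 * linkC B ≤ (4 * B + 3) * linkM2 B := by
  unfold linkM2 linkC linkW
  exact mul_integral_exp_le_integral_frobNorm_sub_one_sq_mul_exp hB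

/-- **`linkM2 B / linkC B ∈ [12/(4B+3), 3/B]`** for `B > 0`. [cite: MontvayMunster1994, §3.2.3 (3.96)-(3.97) p.121] -/
theorem linkM2_div_linkC_mem_Icc {B : ℝ} (hB : 0 < B) : linkM2 B / linkC B ∈ Set.Icc (12 / (4 * B + 3)) (3 / B) := by
  unfold linkM2 linkC linkW
  exact integral_frobNorm_sub_one_sq_mul_exp_div_mem_Icc hB

/-- **THE SHARP SECOND MOMENT `|linkM2 B / linkC B − 3/B| ≤ 9/(4B²)`** for `B > 0` (card v2 §2 `oneLink_frobSq_moment_sharp`, `C = 9/4`; the true second-order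
term is `−3/(8B²)`). [cite: MontvayMunster1994, §3.2.3 (3.96)-(3.97) p.121] -/
theorem abs_linkM2_div_linkC_sub_le {B : ℝ} (hB : 0 < B) : |linkM2 B / linkC B - 3 / B| ≤ 9 / (4 * B ^ 2) := by
  unfold linkM2 linkC linkW
  exact abs_integral_frobNorm_sub_one_sq_mul_exp_div_sub_le hB

/-- **Fourth Hilbert–Schmidt moment, exact**: `B · ∫ ‖W−1‖_F⁴ e^{B Re tr W} dW = 2(4B+3) · linkM2 B − 24 · linkC B` for every real `B`. [cite: DLMF, 10.29.1] -/
theorem linkM4_eq (B : ℝ) :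
    B * ∫ W, frobNorm ((W : Matrix (Fin 2) (Fin 2) ℂ) - 1) ^ 4 * linkW B W ∂haarProbability SU2 = 2 * (4 * B + 3) * linkM2 B - 24 * linkC B := by
  unfold linkM2 linkC linkW
  exact mul_integral_frobNorm_sub_one_pow_four_mul_exp_eq B

/-- **Fourth Hilbert–Schmidt moment, bound**: `∫ ‖W−1‖_F⁴ e^{B Re tr W} dW ≤ (15/B²) · linkC B` for `B > 0`.
[cite: MontvayMunster1994, §3.2.3 (3.96)-(3.97) p.121] -/
theorem linkM4_le {B : ℝ} (hB : 0 < B) :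
    ∫ W, frobNorm ((W : Matrix (Fin 2) (Fin 2) ℂ) - 1) ^ 4 * linkW B W ∂haarProbability SU2 ≤ 15 / B ^ 2 * linkC B := by
  unfold linkC linkW
  exact integral_frobNorm_sub_one_pow_four_mul_exp_le hB

/-- The fourth moment in expectation form: `(∫ ‖W−1‖_F⁴ e^{B Re tr W} dW) / linkC B ≤ 15/B²` for `B > 0`. [cite: MontvayMunster1994, §3.2.3 (3.96)-(3.97) p.121] -/
theorem linkM4_div_linkC_le {B : ℝ} (hB : 0 < B) :
    (∫ W, frobNorm ((W : Matrix (Fin 2) (Fin 2) ℂ) - 1) ^ 4 * linkW B W ∂haarProbability SU2) / linkC B ≤ 15 / B ^ 2 := by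
  unfold linkC linkW
  exact integral_frobNorm_sub_one_pow_four_mul_exp_div_le hB

end Summit.QuantumFields.YangMills.Theorems.FemtoTransferGap
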